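import Mathlib.LinearAlgebra.Matrix.NonsingularInverse
import Literature.Computation.FiniteGraph.SpinSums
import HarnessLib

/-!
# Finite-graph witness engine, II: certified inverse of the Ising second-moment matrix

Topic `Literature/Computation/FiniteGraph`; everything proved, no facts. For the pair-interaction
Ising model on `Fin n` with rational bond parameters `tanh Kᵢ = aᵢ/bᵢ` (file `SpinSums.lean`), the
second-moment matrix `Σ_{pq} = ⟨σ_p σ_q⟩` (the tree's
`Matrix.of fun p q => gksExpect univ K C (fun ω => spinAt p ω * spinAt q ω)`) is rational. This
file turns the question "is the entry `(Σ⁻¹)_{xy}` positive?" — the finitely refutable content of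
inverse-`M`-matrix claims about ferromagnets (Lauritzen–Uhler–Zwiernik 2021, §5, for the sign
pattern of `Σ⁻¹`; the Ising side is Friedli–Velenik 2017, §3.8.1) — into ONE Boolean check that the
kernel (`decide +kernel`) or the compiler (`native_decide`) evaluates:

* `corrNumZ n L` — all `n²` integer numerators `Z·⟨σ_i σ_j⟩` in ONE pass over the `2^n`
  configurations (`cfgSumL`, list-valued binary-split sum); `corrNumZ_getD` identifies entry
  `i·n + j` with `isingSumZ n L [i, j]`;
* `invCheck n B N Z` — exact check of `B · N = Z · 1` for a candidate rational inverse `B` given as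
  rows `List (List ℚ)`; `imCertCheck n L B x y` — bonds well formed (`u, v < n`, `u ≠ v`,
  `0 ≤ a < b`, i.e. ferromagnetic `t ∈ [0,1)`), `Z ≠ 0`, `B·Σ = 1`, `x ≠ y`, `B_{xy} > 0`;
* **`exists_inv_entry_pos_of_imCertCheck`** — soundness: if the check passes then there are
  couplings `K ≥ 0` (namely `artanh (aᵢ/bᵢ)`) on two-element sets `C i = {uᵢ, vᵢ}` and sites
  `p ≠ q` of `Fin n` with `0 < (Σ⁻¹)_{pq}`, `Σ` being literally the tree's `gksExpect` matrix. This
  is the negation-shaped instance of any claim "`(Σ⁻¹)_{xy} ≤ 0` for all finite ferromagnetic pair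
  models"; a consumer closes such a refutation in three lines. (No such certificate is asserted here:
  the file is the checker, not a claim about any particular graph.)
* `modelK`, `modelC`, `model_corrMatrix_eq`, `model_corrMatrix_inv_eq` — the canonical model of a bond
  list with its EXACT `Σ` (`= isingExpect`, cast) and, from a passing `invCheck`, its exact `Σ⁻¹`
  (`= entryQ B`, cast): every entry certified, for comparisons of precision entries across couplings.
* `imNonposCheck n L B`, **`inv_entry_nonpos_of_imNonposCheck`** (appended 2026-08-17) — the
  POSITIVE-evidence checker: `B · Σ = 1` exactly and every off-diagonal `B_{xy} ≤ 0`, whence the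
  model `(modelK L, modelC n L)` has the inverse-`M` property `(Σ⁻¹)_{xy} ≤ 0` (`x ≠ y`) — the
  conclusion of `InverseMFerromagnet` for that finite ferromagnet.

The certificate `B` and the graph come from the external generator (`kit/fgwe/fgwe.py ising --cert`,
exact `fmpq_mat` inverse on the compute pool); the kernel re-verifies everything, so the generator is
untrusted tooling. Cost: one pass of `2^n · (m + n²)` integer operations plus `n³` rational ones;
`n = 8` runs in seconds under `decide +kernel`.

## References
* S. Friedli, Y. Velenik, *Statistical Mechanics of Lattice Systems*, CUP 2017, §3.8.1
  [FriedliVelenik2017].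
* S. Lauritzen, C. Uhler, P. Zwiernik, *Total positivity in exponential families with application to
  binary variables*, Ann. Statist. 49 (2021), §5 [LauritzenUhlerZwiernik2021].
-/

namespace Literature.Computation.FiniteGraph

open Finset Literature.Probability.LatticeModels

/-! ### List-valued configuration sums (all pair correlations in one pass) -/

/-- Pointwise sum of two integer lists, the shorter one padded with zeros. [folklore] -/
def addL : List ℤ → List ℤ → List ℤ
  | [], l => l
  | x :: xs, [] => x :: xs
  | x :: xs, y :: ys => (x + y) :: addL xs ys

/-- `addL` is pointwise addition for the default-`0` accessor. [folklore] -/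
theorem getD_addL : ∀ (xs ys : List ℤ) (i : ℕ), (addL xs ys).getD i 0 = xs.getD i 0 + ys.getD i 0
  | [], ys, i => by simp [addL]
  | x :: xs, [], i => by simp [addL]
  | x :: xs, y :: ys, 0 => by simp [addL]
  | x :: xs, y :: ys, i + 1 => by
      rw [addL, List.getD_cons_succ, List.getD_cons_succ, List.getD_cons_succ, getD_addL xs ys i]

/-- List-valued binary-split sum over the `2^k` configuration codes of a dyadic block. [folklore] -/
def cfgSumL (f : ℕ → List ℤ) : ℕ → ℕ → List ℤ
  | 0, c => f c
  | k + 1, c => addL (cfgSumL f k (2 * c)) (cfgSumL f k (2 * c + 1))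

/-- Each entry of `cfgSumL` is the scalar `cfgSum` of that entry. [folklore] -/
theorem getD_cfgSumL (f : ℕ → List ℤ) (i : ℕ) :
    ∀ k c : ℕ, (cfgSumL f k c).getD i 0 = cfgSum (fun c => (f c).getD i 0) k c
  | 0, c => rfl
  | k + 1, c => by rw [cfgSumL, cfgSum, getD_addL, getD_cfgSumL f i k, getD_cfgSumL f i k]

/-- The row-major `n × n` table `w · σ_i σ_j` of one configuration. [folklore] -/
def pairRow (n c : ℕ) (w : ℤ) : List ℤ :=
  (List.range (n * n)).map fun idx => w * (spinZ c (idx / n) * spinZ c (idx % n))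

/-- Entry `(i, j)` of `pairRow`. [folklore] -/
theorem getD_pairRow {n i j : ℕ} (hi : i < n) (hj : j < n) (c : ℕ) (w : ℤ) :
    (pairRow n c w).getD (i * n + j) 0 = w * (spinZ c i * spinZ c j) := by
  have hn : 0 < n := lt_of_le_of_lt (Nat.zero_le _) hi
  have hlt : i * n + j < n * n := by nlinarith
  rw [pairRow, List.getD_eq_getElem?_getD, List.getElem?_map, List.getElem?_range hlt]
  simp only [Option.map_some, Option.getD_some]
  rw [show i * n + j = j + i * n by ring, Nat.add_mul_div_right _ _ hn, Nat.add_mul_mod_self_right,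
    Nat.div_eq_of_lt hj, Nat.mod_eq_of_lt hj, zero_add]

/-- **All numerators at once**: the table of `Σ_c σ_i σ_j ∏ (b + a σ_u σ_v)` for `i, j < n`, computed
in one pass over the configurations. [folklore] -/
def corrNumZ (n : ℕ) (L : List IsingBond) : List ℤ :=
  cfgSumL (fun c => pairRow n c (bondProdZ c L)) n 0

/-- Entry `(i, j)` of `corrNumZ` is the two-point numerator `isingSumZ n L [i, j]`. [folklore] -/
theorem corrNumZ_getD {n : ℕ} (L : List IsingBond) {i j : ℕ} (hi : i < n) (hj : j < n) :
    (corrNumZ n L).getD (i * n + j) 0 = isingSumZ n L [i, j] := by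
  rw [corrNumZ, getD_cfgSumL, isingSumZ]
  congr 1
  funext c
  rw [getD_pairRow hi hj]
  simp only [monoProdZ]
  ring

/-! ### The inverse certificate -/

/-- `Σ_{k < N} f k` over `ℚ` by structural recursion. [folklore] -/
def natSumQ (f : ℕ → ℚ) : ℕ → ℚ
  | 0 => 0
  | N + 1 => natSumQ f N + f N

/-- `natSumQ` is the `Finset.range` sum. [folklore] -/
theorem natSumQ_eq_sum_range (f : ℕ → ℚ) : ∀ N : ℕ, natSumQ f N = ∑ k ∈ range N, f k
  | 0 => by simp [natSumQ]
  | N + 1 => by rw [natSumQ, natSumQ_eq_sum_range f N, Finset.sum_range_succ]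

/-- Entry `(i, k)` of a matrix given by rows (default `0`). [folklore] -/
def entryQ (B : List (List ℚ)) (i k : ℕ) : ℚ := (B.getD i []).getD k 0

/-- Exact check of `B · N = Z · 1` (`N` the row-major integer numerator table of `Σ`, `Z` the common
denominator), i.e. of `B · Σ = 1`. [folklore] -/
def invCheck (n : ℕ) (B : List (List ℚ)) (N : List ℤ) (Z : ℤ) : Bool :=
  (List.range n).all fun i => (List.range n).all fun j =>
    natSumQ (fun k => entryQ B i k * ((N.getD (k * n + j) 0 : ℤ) : ℚ)) n == (if i = j then (Z : ℚ) else 0)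

/-- Well-formed ferromagnetic bond data on `n` sites: endpoints `< n` and distinct, parameter
`0 ≤ a/b < 1`. [folklore] -/
def bondsOK (n : ℕ) (L : List IsingBond) : Bool :=
  L.all fun e => decide (e.1 < n) && decide (e.2.1 < n) && !(e.1 == e.2.1) &&
    decide (0 ≤ e.2.2.1) && decide (e.2.2.1 < (e.2.2.2 : ℤ))

/-- **The certificate checker** for "`(Σ⁻¹)_{xy} > 0`": bonds well formed, `Z ≠ 0`, `B` is an exact
left inverse of `Σ`, `x ≠ y < n`, and `B_{xy} > 0`. [folklore] -/
def imCertCheck (n : ℕ) (L : List IsingBond) (B : List (List ℚ)) (x y : ℕ) : Bool :=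
  decide (x < n) && decide (y < n) && !(x == y) && bondsOK n L &&
    !(isingSumZ n L [] == 0) && invCheck n B (corrNumZ n L) (isingSumZ n L []) &&
    decide (0 < entryQ B x y)

/-- Soundness of `invCheck`: the checked identity, entrywise over `Fin n`. [folklore] -/
theorem sum_entryQ_mul_of_invCheck {n : ℕ} {B : List (List ℚ)} {N : List ℤ} {Z : ℤ}
    (h : invCheck n B N Z = true) (i j : Fin n) :
    ∑ k : Fin n, entryQ B i k * ((N.getD (k * n + j) 0 : ℤ) : ℚ) = if i = j then (Z : ℚ) else 0 := by
  simp only [invCheck, List.all_eq_true, List.mem_range, beq_iff_eq] at h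
  have h' := h i i.2 j j.2
  rw [natSumQ_eq_sum_range, ← Fin.sum_univ_eq_sum_range
    (fun k => entryQ B i k * ((N.getD (k * n + j) 0 : ℤ) : ℚ)) n] at h'
  rw [h']
  simp [Fin.val_eq_val]

/-- Soundness of `bondsOK`, bond by bond. [folklore] -/
theorem bondsOK_get {n : ℕ} {L : List IsingBond} (h : bondsOK n L = true) (i : Fin L.length) :
    (L.get i).1 < n ∧ (L.get i).2.1 < n ∧ (L.get i).1 ≠ (L.get i).2.1 ∧
      0 ≤ (L.get i).2.2.1 ∧ (L.get i).2.2.1 < ((L.get i).2.2.2 : ℤ) := by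
  simp only [bondsOK, List.all_eq_true, Bool.and_eq_true, decide_eq_true_eq, Bool.not_eq_true',
    beq_eq_false_iff_ne, ne_eq] at h
  obtain ⟨⟨⟨⟨h1, h2⟩, h3⟩, h4⟩, h5⟩ := h _ (List.get_mem L i)
  exact ⟨h1, h2, h3, h4, h5⟩

/-- **Soundness of the certificate.** If `imCertCheck n L B x y` passes then the ferromagnetic pair
model with couplings `Kᵢ = artanh (aᵢ/bᵢ) ≥ 0` on the bonds `Cᵢ = {uᵢ, vᵢ}` of `L` has two distinct
sites `p, q` (namely `x, y`) with `0 < (Σ⁻¹)_{pq}`, where `Σ_{rs} = ⟨σ_r σ_s⟩` is the tree's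
`gksExpect` second-moment matrix and `⁻¹` is `Matrix.inv`. [cite: FriedliVelenik2017, §3.8.1] -/
theorem exists_inv_entry_pos_of_imCertCheck (n : ℕ) (L : List IsingBond) (B : List (List ℚ))
    (x y : ℕ) (h : imCertCheck n L B x y = true) :
    ∃ (m : ℕ) (K : Fin m → ℝ) (C : Fin m → Finset (Fin n)) (p q : Fin n),
      (∀ i, 0 ≤ K i) ∧ (∀ i, (C i).card = 2) ∧ p ≠ q ∧
      0 < (Matrix.of fun r s : Fin n =>
        gksExpect Finset.univ K C (fun ω => spinAt r ω * spinAt s ω))⁻¹ p q := by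
  simp only [imCertCheck, Bool.and_eq_true, decide_eq_true_eq, Bool.not_eq_true', beq_eq_false_iff_ne,
    ne_eq] at h
  obtain ⟨⟨⟨⟨⟨⟨hx, hy⟩, hxy⟩, hL⟩, hZ⟩, hinv⟩, hpos⟩ := h
  -- the data of the pair model
  set m := L.length with hm
  let u : Fin m → Fin n := fun i => ⟨(L.get i).1, (bondsOK_get hL i).1⟩
  let v : Fin m → Fin n := fun i => ⟨(L.get i).2.1, (bondsOK_get hL i).2.1⟩
  let a : Fin m → ℤ := fun i => (L.get i).2.2.1
  let b : Fin m → ℕ := fun i => (L.get i).2.2.2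
  let K : Fin m → ℝ := fun i => Real.artanh ((a i : ℝ) / (b i : ℝ))
  let C : Fin m → Finset (Fin n) := fun i => {u i, v i}
  have huv : ∀ i, u i ≠ v i := fun i hi => (bondsOK_get hL i).2.2.1 (congrArg Fin.val hi)
  have hb0 : ∀ i, b i ≠ 0 := fun i hb => by
    have h4 := (bondsOK_get hL i).2.2.2.1
    have h5 := (bondsOK_get hL i).2.2.2.2
    simp only [b] at hb
    rw [hb] at h5
    push_cast at h5
    omega
  have ht : ∀ i, Real.tanh (K i) = (a i : ℝ) / (b i : ℝ) := fun i => by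
    have h4 := (bondsOK_get hL i).2.2.2.1
    have h5 := (bondsOK_get hL i).2.2.2.2
    exact tanh_artanh_div (by change -((L.get i).2.2.2 : ℤ) < (L.get i).2.2.1; omega) h5
  have hbonds : bondsOfFn u v a b = L := by
    rw [bondsOfFn]
    exact List.ofFn_get L
  -- the rational matrices
  let N := corrNumZ n L
  let Z := isingSumZ n L []
  let SQ : Matrix (Fin n) (Fin n) ℚ := Matrix.of fun r s => isingExpect n L [(r : ℕ), (s : ℕ)]
  let BQ : Matrix (Fin n) (Fin n) ℚ := Matrix.of fun r s => entryQ B r s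
  have hZ' : (Z : ℚ) ≠ 0 := by exact_mod_cast hZ
  have hBS : BQ * SQ = 1 := by
    ext r s
    rw [Matrix.mul_apply]
    have hk : ∀ k : Fin n, BQ r k * SQ k s = entryQ B r k * ((N.getD (k * n + s) 0 : ℤ) : ℚ) / (Z : ℚ) := by
      intro k
      simp only [BQ, SQ, Matrix.of_apply, isingExpect, N, Z]
      rw [← corrNumZ_getD L k.2 s.2, mul_div_assoc]
    rw [Matrix.one_apply, Finset.sum_congr rfl fun k _ => hk k, ← Finset.sum_div,
      sum_entryQ_mul_of_invCheck hinv r s]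
    split_ifs
    · exact div_self hZ'
    · exact zero_div _
  -- the real matrix is the cast of `SQ`
  have hS : (Matrix.of fun r s : Fin n => gksExpect Finset.univ K C (fun ω => spinAt r ω * spinAt s ω)) =
      SQ.map (Rat.castHom ℝ) := by
    ext r s
    simp only [Matrix.map_apply, Matrix.of_apply, Rat.coe_castHom, SQ]
    rw [gksExpect_spinAt_mul_spinAt_eq K C u v a b (fun _ => rfl) huv hb0 ht r s, hbonds]
  have hInv : (Matrix.of fun r s : Fin n =>
      gksExpect Finset.univ K C (fun ω => spinAt r ω * spinAt s ω))⁻¹ = BQ.map (Rat.castHom ℝ) := by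
    rw [hS]
    apply Matrix.inv_eq_left_inv
    rw [← Matrix.map_mul, hBS, Matrix.map_one _ (map_zero _) (map_one _)]
  refine ⟨m, K, C, ⟨x, hx⟩, ⟨y, hy⟩, fun i => ?_, fun i => Finset.card_pair (huv i),
    fun hpq => hxy (congrArg Fin.val hpq), ?_⟩
  · exact artanh_div_nonneg (b i) (bondsOK_get hL i).2.2.2.1
  · rw [hInv]
    simp only [Matrix.map_apply, Matrix.of_apply, Rat.coe_castHom, BQ]
    exact_mod_cast hpos

/-! ### The canonical model of a bond list: exact `Σ` and exact `Σ⁻¹` -/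

/-- The couplings `Kᵢ = artanh (aᵢ/bᵢ)` of a bond list. [folklore] -/
noncomputable def modelK (L : List IsingBond) : Fin L.length → ℝ :=
  fun i => Real.artanh (((L.get i).2.2.1 : ℝ) / ((L.get i).2.2.2 : ℝ))

/-- The two-site interaction sets `Cᵢ = {uᵢ, vᵢ}` of a well-formed bond list. [folklore] -/
def modelC (n : ℕ) (L : List IsingBond) (hL : bondsOK n L = true) : Fin L.length → Finset (Fin n) :=
  fun i => {⟨(L.get i).1, (bondsOK_get hL i).1⟩, ⟨(L.get i).2.1, (bondsOK_get hL i).2.1⟩}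

/-- The couplings of a well-formed (ferromagnetic) bond list are nonnegative. [folklore] -/
theorem modelK_nonneg {n : ℕ} {L : List IsingBond} (hL : bondsOK n L = true) (i : Fin L.length) : 0 ≤ modelK L i :=
  artanh_div_nonneg _ (bondsOK_get hL i).2.2.2.1

/-- The interaction sets of a well-formed bond list have two elements. [folklore] -/
theorem card_modelC {n : ℕ} {L : List IsingBond} (hL : bondsOK n L = true) (i : Fin L.length) :
    (modelC n L hL i).card = 2 :=
  Finset.card_pair fun h => (bondsOK_get hL i).2.2.1 (congrArg Fin.val h)

/-- **Exact second-moment matrix of the canonical model**: the tree's `gksExpect` matrix of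
`(modelK L, modelC n L)` is the rational matrix `(isingExpect n L [r, s])`, cast. [cite: FriedliVelenik2017, §3.8.1] -/
theorem model_corrMatrix_eq {n : ℕ} (L : List IsingBond) (hL : bondsOK n L = true) :
    (Matrix.of fun r s : Fin n => gksExpect Finset.univ (modelK L) (modelC n L hL) (fun ω => spinAt r ω * spinAt s ω)) =
      (Matrix.of fun r s : Fin n => isingExpect n L [(r : ℕ), (s : ℕ)]).map (Rat.castHom ℝ) := by
  have huv : ∀ i : Fin L.length, (⟨(L.get i).1, (bondsOK_get hL i).1⟩ : Fin n) ≠ ⟨(L.get i).2.1, (bondsOK_get hL i).2.1⟩ :=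
    fun i hi => (bondsOK_get hL i).2.2.1 (congrArg Fin.val hi)
  have hb0 : ∀ i : Fin L.length, (L.get i).2.2.2 ≠ 0 := fun i hb => by
    have h4 := (bondsOK_get hL i).2.2.2.1
    have h5 := (bondsOK_get hL i).2.2.2.2
    rw [hb] at h5
    push_cast at h5
    omega
  have ht : ∀ i : Fin L.length, Real.tanh (modelK L i) = ((L.get i).2.2.1 : ℝ) / ((L.get i).2.2.2 : ℝ) := fun i =>
    tanh_artanh_div (by have := (bondsOK_get hL i).2.2.2.1; have := (bondsOK_get hL i).2.2.2.2; omega)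
      (bondsOK_get hL i).2.2.2.2
  have hbonds : bondsOfFn (fun i : Fin L.length => (⟨(L.get i).1, (bondsOK_get hL i).1⟩ : Fin n))
      (fun i => ⟨(L.get i).2.1, (bondsOK_get hL i).2.1⟩) (fun i => (L.get i).2.2.1) (fun i => (L.get i).2.2.2) = L := by
    rw [bondsOfFn]
    exact List.ofFn_get L
  ext r s
  simp only [Matrix.map_apply, Matrix.of_apply, Rat.coe_castHom]
  rw [gksExpect_spinAt_mul_spinAt_eq (modelK L) (modelC n L hL) _ _ _ _ (fun _ => rfl) huv hb0 ht r s, hbonds]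

/-- **Exact inverse of the canonical model from a passing `invCheck`**: if `B` passes the exact
inverse check (and `Z ≠ 0`) then `Σ⁻¹` is the rational matrix `(entryQ B r s)`, cast — every entry of
`Σ⁻¹` is thereby certified, not only a sign. [folklore] -/
theorem model_corrMatrix_inv_eq {n : ℕ} (L : List IsingBond) (hL : bondsOK n L = true) (B : List (List ℚ))
    (hZ : isingSumZ n L [] ≠ 0) (hinv : invCheck n B (corrNumZ n L) (isingSumZ n L []) = true) :
    (Matrix.of fun r s : Fin n => gksExpect Finset.univ (modelK L) (modelC n L hL) (fun ω => spinAt r ω * spinAt s ω))⁻¹ =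
      (Matrix.of fun r s : Fin n => entryQ B r s).map (Rat.castHom ℝ) := by
  have hZ' : (isingSumZ n L [] : ℚ) ≠ 0 := by exact_mod_cast hZ
  have hBS : (Matrix.of fun r s : Fin n => entryQ B r s) * (Matrix.of fun r s : Fin n => isingExpect n L [(r : ℕ), (s : ℕ)]) = 1 := by
    ext r s
    rw [Matrix.mul_apply, Matrix.one_apply]
    have hk : ∀ k : Fin n, (Matrix.of fun r s : Fin n => entryQ B r s) r k *
        (Matrix.of fun r s : Fin n => isingExpect n L [(r : ℕ), (s : ℕ)]) k s =
        entryQ B r k * (((corrNumZ n L).getD (k * n + s) 0 : ℤ) : ℚ) / (isingSumZ n L [] : ℚ) := by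
      intro k
      simp only [Matrix.of_apply, isingExpect]
      rw [← corrNumZ_getD L k.2 s.2, mul_div_assoc]
    rw [Finset.sum_congr rfl fun k _ => hk k, ← Finset.sum_div, sum_entryQ_mul_of_invCheck hinv r s]
    split_ifs
    · exact div_self hZ'
    · exact zero_div _
  rw [model_corrMatrix_eq L hL]
  apply Matrix.inv_eq_left_inv
  rw [← Matrix.map_mul, hBS, Matrix.map_one _ (map_zero _) (map_one _)]

/-! ### Kernel regression examples (triangle, `t = 3/5`; an `n = 8`, 11-bond certificate takes ≈ 5 s) -/

/-- The exact inverse of `Σ` for the triangle passes `invCheck`. -/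
example : invCheck 3 [[(323 : ℚ) / 98, (-285 : ℚ) / 196, (-285 : ℚ) / 196],
      [(-285 : ℚ) / 196, (323 : ℚ) / 98, (-285 : ℚ) / 196], [(-285 : ℚ) / 196, (-285 : ℚ) / 196, (323 : ℚ) / 98]]
    (corrNumZ 3 [(0, 1, 3, 5), (1, 2, 3, 5), (0, 2, 3, 5)])
    (isingSumZ 3 [(0, 1, 3, 5), (1, 2, 3, 5), (0, 2, 3, 5)] []) = true := by
  decide +kernel

/-- … and, the off-diagonal entries of `Σ⁻¹` being negative there, the sign certificate is rejected. -/
example : imCertCheck 3 [(0, 1, 3, 5), (1, 2, 3, 5), (0, 2, 3, 5)]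
    [[(323 : ℚ) / 98, (-285 : ℚ) / 196, (-285 : ℚ) / 196], [(-285 : ℚ) / 196, (323 : ℚ) / 98, (-285 : ℚ) / 196],
      [(-285 : ℚ) / 196, (-285 : ℚ) / 196, (323 : ℚ) / 98]] 0 1 = false := by
  decide +kernel

/-! ### Positive evidence: every off-diagonal entry of `Σ⁻¹` is nonpositive (appended 2026-08-17, gen 2) -/

/-- Row-major scan of the candidate inverse: `B_{ij} ≤ 0` for all `i ≠ j < n`. [folklore] -/
def offDiagNonpos (n : ℕ) (B : List (List ℚ)) : Bool :=
  (List.range n).all fun i => (List.range n).all fun j => (i == j) || decide (entryQ B i j ≤ 0)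

/-- **The positive-evidence checker** for the inverse-`M` property of ONE model: bonds well formed and
ferromagnetic, `Z ≠ 0`, `B · Σ = 1` exactly, and every off-diagonal entry of `B` is `≤ 0`. [folklore] -/
def imNonposCheck (n : ℕ) (L : List IsingBond) (B : List (List ℚ)) : Bool :=
  bondsOK n L && !(isingSumZ n L [] == 0) && invCheck n B (corrNumZ n L) (isingSumZ n L []) && offDiagNonpos n B

/-- A passing check has well-formed bonds. [folklore] -/
theorem bondsOK_of_imNonposCheck {n : ℕ} {L : List IsingBond} {B : List (List ℚ)} (h : imNonposCheck n L B = true) :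
    bondsOK n L = true := by
  simp only [imNonposCheck, Bool.and_eq_true] at h
  exact h.1.1.1

/-- **Soundness: the model is inverse-`M`.** If `imNonposCheck n L B` passes then, for the canonical
couplings `Kᵢ = artanh (aᵢ/bᵢ) ≥ 0` (`modelK`) on the bonds `Cᵢ = {uᵢ, vᵢ}` (`modelC`), every
off-diagonal entry of the inverse of the tree's `gksExpect` second-moment matrix is `≤ 0` — the
conclusion of `InverseMFerromagnet` for this finite ferromagnet, certified by one `decide`. [cite: FriedliVelenik2017, §3.8.1] -/
theorem inv_entry_nonpos_of_imNonposCheck {n : ℕ} {L : List IsingBond} {B : List (List ℚ)}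
    (h : imNonposCheck n L B = true) (x y : Fin n) (hxy : x ≠ y) :
    (Matrix.of fun r s : Fin n => gksExpect Finset.univ (modelK L) (modelC n L (bondsOK_of_imNonposCheck h))
      (fun ω => spinAt r ω * spinAt s ω))⁻¹ x y ≤ 0 := by
  have h' := h
  simp only [imNonposCheck, Bool.and_eq_true, Bool.not_eq_true', beq_eq_false_iff_ne, ne_eq] at h'
  obtain ⟨⟨⟨hL, hZ⟩, hinv⟩, hoff⟩ := h'
  rw [model_corrMatrix_inv_eq L (bondsOK_of_imNonposCheck h) B hZ hinv]
  simp only [Matrix.map_apply, Matrix.of_apply, Rat.coe_castHom]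
  simp only [offDiagNonpos, List.all_eq_true, List.mem_range, Bool.or_eq_true, beq_iff_eq, decide_eq_true_eq] at hoff
  rcases hoff x x.2 y y.2 with hxy' | hle
  · exact absurd (Fin.ext hxy') hxy
  · exact_mod_cast hle

/-- Triangle, `t = 3/5`: `Σ⁻¹` (entries `323/98`, `−285/196`) is a `Z`-matrix, so the positive-evidence
check passes. -/
example : imNonposCheck 3 [(0, 1, 3, 5), (1, 2, 3, 5), (0, 2, 3, 5)]
    [[(323 : ℚ) / 98, (-285 : ℚ) / 196, (-285 : ℚ) / 196], [(-285 : ℚ) / 196, (323 : ℚ) / 98, (-285 : ℚ) / 196],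
      [(-285 : ℚ) / 196, (-285 : ℚ) / 196, (323 : ℚ) / 98]] = true := by
  decide +kernel

end Literature.Computation.FiniteGraph
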